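/-
Copyright (c) 2026 the pub-hodgecm-mathlib formalisation cell (harness21).  Prover seat hodgecm-mathlib-LH4-p06 (g2): Track A «(D-RAM) FOUR-FRAME» squad of crux H413
(U2H ED. 9 plan: the three scalar inputs of (ρ1′) `stub_U2H_rowOne_unit0` at the explicit coefficients coef*), 2026-09-03.
-/
import Summits.HodgeConjecture.HodgeConjecture.Theorems.F0P3cDyRamFourFrameLawDefsR    -- ★ №1-R: `shiftR`
import Literature.NumberTheory.Automorphic.UnitaryThreeFourFrameDefs                    -- ★ `depthOfRecord`
import Summits.HodgeConjecture.HodgeConjecture.Theorems.F0P3cDyRamRowOneReductionDepth   -- ★ p855481 (LH4-p06 (g0)): `rowOne_of_hSideIdentity_depth`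
import Summits.HodgeConjecture.HodgeConjecture.Theorems.F0P3cDyRamRowOneHSideAssembly    -- ★ p855670 (LH4-p08 (g2)): `hH_rowOne_hFamily_of_affine`
import Summits.HodgeConjecture.HodgeConjecture.Theorems.F0P3cDyRamRowThreeReduction      -- ★ p855734 (LH4-p06 (g2)): `measureReal_support_hFamily_ne_zero`
import HarnessLib

/-!
# F0 · P3c · line LH4 «(D-RAM) FOUR-FRAME» — unit (ii-H): THE THREE SCALAR INPUTS OF ROW (1) AT THE EXPLICIT COEFFICIENTS coef* (`hκ`, `hlam`, `hn` of ★ p855670)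
(Rogawski 1990 §4.9 Prop. 4.9.1 (b))

Cell `pub/hodgecm-mathlib`, crux H413 = `stmt-HodgeConjecture-24833` (helper lane); THEOREMS ONLY (no definition, no instance, no notation, no named fact, no `sorry`).  Pure algebra
over `ℂ`∕`ℚ`∕`ℕ`: with `coef* s = (if s = s_V then C(q+1−2q^S) else 2C(q^S−1)) ∕ ((q−1)ν_s)` (`s_V = d % 2`), `κ* s = 2ν_s`, `lam* s = (if s = s_V then 0 else −2ν_s)`,
`n* N = (N − d)∕2`: (i) `Σ_s coef*_s κ*_s = 2C`; (ii) `Σ_s coef*_s lam*_s = −C·(4(q^S − 1)∕(q − 1))` (the `ℚ → ℂ` cast of ★ p855670's `hlam` included); (iii) `(n* N : ℤ) + 1 = (N + 2 − d)∕2`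
for `depthOfRecord d ≤ N`, `N + d` even.  These are the binders `hκ`, `hlam`, `hn` of ★ `F0P3cDyRamRowOneHSideAssembly.hH_rowOne_hFamily_of_affine` at `(coef*, κ*, lam*, n*)`.

HONEST LABEL: HC_CM is proved only modulo the 7 printed citations (2 remaining named inputs: hLiu418 = stmt-HodgeConjecture-24832, h413 = stmt-HodgeConjecture-24833) until
rung 0 closes; count-neutral algebra.

## References
* [Rogawski1990] J. D. Rogawski, *Automorphic Representations of Unitary Groups in Three Variables*, Ann. of Math. Stud. 123 (1990): §4.9 Prop. 4.9.1 (b) p. 55.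
-/

set_option autoImplicit false

noncomputable section

open scoped Matrix MatrixGroups Classical ValuativeRel WithZero Topology   -- the LINE FILE's scopes: `𝒪[K]` = `Valuation.integer (valuation K)` (ValuativeRel), as in (ρ)'s `_h2` binder
open MeasureTheory Measure NumberField IsDedekindDomain Matrix Filter
open Literature.NumberTheory.Automorphic Literature.NumberTheory.Automorphic.UnitaryGroup Literature.NumberTheory.Automorphic.HermitianLattice
open Literature.NumberTheory.Automorphic.UnitaryLatticeTree Literature.NumberTheory.Rogawski1990 Literature.NumberTheory.GaloisRepresentations
open Literature.NumberTheory.Automorphic.UnitaryThreeFourFrame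
open Summit.HodgeConjecture.HodgeConjecture.Cruxes.H413.F0P3cDyRamFourFrameHFamilyDefs
open Summit.HodgeConjecture.HodgeConjecture.Cruxes.H413.F0P3cDyRamFourFrameLawDefsR (shiftR)

namespace Summit.HodgeConjecture.HodgeConjecture.Cruxes.H413.F0P3cDyRamRowOneAtCoefStar

/-! ## §1 The three scalar inputs at coef* -/

/-- **`Σ_s coef*_s · κ*_s = 2C`** (`κ*_s = 2ν_s`; `q ≠ 1`, `ν_s ≠ 0`). [cite: Rogawski1990, §4.9 Prop. 4.9.1 (b) p. 55] -/
theorem sum_coefStar_mul_kappaStar {C q ν₀ ν₁ : ℂ} (hq : q - 1 ≠ 0) (hν₀ : ν₀ ≠ 0) (hν₁ : ν₁ ≠ 0) (d : ℕ) (S : ℤ) :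
    (if ((0 : Fin 2) : ℕ) = d % 2 then C * ((q + 1) - 2 * q ^ S) else 2 * C * (q ^ S - 1)) / ((q - 1) * ν₀) * (2 * ν₀) +
      (if ((1 : Fin 2) : ℕ) = d % 2 then C * ((q + 1) - 2 * q ^ S) else 2 * C * (q ^ S - 1)) / ((q - 1) * ν₁) * (2 * ν₁) = 2 * C := by
  rcases Nat.mod_two_eq_zero_or_one d with hd | hd
  · simp only [hd, Fin.val_zero, Fin.val_one, if_true, one_ne_zero, if_false]
    field_simp
    ring
  · simp only [hd, Fin.val_zero, Fin.val_one, zero_ne_one, if_false, if_true]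
    field_simp
    ring

/-- **`Σ_s coef*_s · lam*_s = −C·(4(q^S − 1)∕(q − 1))`** in `ℂ` (`lam*_s = 0` on the vertex profile, `−2ν_s` on the other). [cite: Rogawski1990, §4.9 Prop. 4.9.1 (b) p. 55] -/
theorem sum_coefStar_mul_lamStar {C q ν₀ ν₁ : ℂ} (hq : q - 1 ≠ 0) (hν₀ : ν₀ ≠ 0) (hν₁ : ν₁ ≠ 0) (d : ℕ) (S : ℤ) :
    (if ((0 : Fin 2) : ℕ) = d % 2 then C * ((q + 1) - 2 * q ^ S) else 2 * C * (q ^ S - 1)) / ((q - 1) * ν₀) *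
        (if ((0 : Fin 2) : ℕ) = d % 2 then 0 else -2 * ν₀) +
      (if ((1 : Fin 2) : ℕ) = d % 2 then C * ((q + 1) - 2 * q ^ S) else 2 * C * (q ^ S - 1)) / ((q - 1) * ν₁) *
        (if ((1 : Fin 2) : ℕ) = d % 2 then 0 else -2 * ν₁) = -(C * (4 * (q ^ S - 1) / (q - 1))) := by
  rcases Nat.mod_two_eq_zero_or_one d with hd | hd
  · simp only [hd, Fin.val_zero, Fin.val_one, if_true, one_ne_zero, if_false]
    field_simp
    ring
  · simp only [hd, Fin.val_zero, Fin.val_one, zero_ne_one, if_false, if_true]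
    field_simp
    ring

/-- The `ℚ → ℂ` cast of ★ p855670's `hlam` right-hand side: `((4(q^S − 1)∕(q − 1) : ℚ) : ℂ) = 4((q:ℂ)^S − 1)∕((q:ℂ) − 1)`. [cite: Rogawski1990, §4.9 Prop. 4.9.1 (b) p. 55] -/
theorem cast_four_mul_zpow_sub_one_div (q : ℕ) (S : ℤ) :
    (((4 * ((q : ℚ) ^ S - 1) / ((q : ℚ) - 1) : ℚ)) : ℂ) = 4 * (((q : ℕ) : ℂ) ^ S - 1) / (((q : ℕ) : ℂ) - 1) := by
  push_cast
  rfl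

/-- **`Σ_s coef*_s · lam*_s = −(C · ↑(4(q^S − 1)∕(q − 1)))`** in ★ p855670's `hlam` currency (`q : ℕ`, the `ℚ` expression cast to `ℂ`). [cite: Rogawski1990, §4.9 Prop. 4.9.1 (b) p. 55] -/
theorem sum_coefStar_mul_lamStar_cast {C ν₀ ν₁ : ℂ} (q : ℕ) (hq : ((q : ℕ) : ℂ) - 1 ≠ 0) (hν₀ : ν₀ ≠ 0) (hν₁ : ν₁ ≠ 0) (d : ℕ) (S : ℤ) :
    (if ((0 : Fin 2) : ℕ) = d % 2 then C * ((((q : ℕ) : ℂ) + 1) - 2 * ((q : ℕ) : ℂ) ^ S) else 2 * C * (((q : ℕ) : ℂ) ^ S - 1)) / ((((q : ℕ) : ℂ) - 1) * ν₀) *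
        (if ((0 : Fin 2) : ℕ) = d % 2 then 0 else -2 * ν₀) +
      (if ((1 : Fin 2) : ℕ) = d % 2 then C * ((((q : ℕ) : ℂ) + 1) - 2 * ((q : ℕ) : ℂ) ^ S) else 2 * C * (((q : ℕ) : ℂ) ^ S - 1)) / ((((q : ℕ) : ℂ) - 1) * ν₁) *
        (if ((1 : Fin 2) : ℕ) = d % 2 then 0 else -2 * ν₁) = -(C * ((((4 * ((q : ℚ) ^ S - 1) / ((q : ℚ) - 1) : ℚ)) : ℂ))) := by
  rw [cast_four_mul_zpow_sub_one_div]
  exact sum_coefStar_mul_lamStar hq hν₀ hν₁ d S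

/-- **The radius function `n* N = (N − d)∕2`** satisfies ★ p855670's `hn`: `(n* N : ℤ) + 1 = (N + 2 − d)∕2` whenever `depthOfRecord d ≤ N` and `N + d` is even
(`depthOfRecord d ≥ d`). [cite: Rogawski1990, §4.9 p. 55] -/
theorem radiusStar_spec (d : ℕ) : ∀ N : ℕ, depthOfRecord d ≤ N → (N + d) % 2 = 0 → ((((N - d) / 2 : ℕ) : ℕ) : ℤ) + 1 = ((N : ℤ) + 2 - d) / 2 := by
  intro N hN hpar
  have hd : d ≤ N := by
    unfold depthOfRecord at hN
    split_ifs at hN <;> omega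
  omega


/-- `(q : ℂ) − 1 ≠ 0` for the residue cardinality `q = #k_w ≥ 2` (the residue ring is a field). [cite: Rogawski1990, §4.9 p. 54] -/
theorem natCast_card_residueField_sub_one_ne_zero (L : Type) [Field L] [NumberField L]
    {v : IsDedekindDomain.HeightOneSpectrum (NumberField.RingOfIntegers ↥(NumberField.maximalRealSubfield L))} (w : Literature.NumberTheory.Automorphic.UnitaryGroup.PlacesOver L v)
    [Fintype (Valued.ResidueField (w.1.adicCompletion L))] :
    ((Fintype.card (Valued.ResidueField (w.1.adicCompletion L)) : ℕ) : ℂ) - 1 ≠ 0 := by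
  haveI : Nontrivial (Valued.ResidueField (w.1.adicCompletion L)) := inferInstance
  refine sub_ne_zero.2 ?_
  exact_mod_cast (Fintype.one_lt_card (α := Valued.ResidueField (w.1.adicCompletion L))).ne'

/-! ## §2 HEAD: ROW (1) of (ρ) at coef*, from the type-(1) dictionary in affine form (ρ1a) -/

section Head

open scoped Classical in
/-- **ROW (1) OF (ρ) AT THE EXPLICIT COEFFICIENTS, FROM THE TYPE-(1) DICTIONARY** — the payer of `stub_U2H_rowOne_unit0` (U2H ED. 9 plan): given the conclusion `h1a` of
(ρ1a) `stub_U2H_hProfiles_typeOne_affine_wild` (★ p855670's `hΦ` at `κ* s = 2ν_s`, `lam* s = [s ≠ s_V]·(−2ν_s)`, `n* N = (N − d)∕2`), ROW (1) of `stub_U2H_rowsR_hFamily_unit0` holds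
with `coef s ↦ coef* s` — ★ p855481 `rowOne_of_hSideIdentity_depth` ∘ ★ p855670 `hH_rowOne_hFamily_of_affine` ∘ §1 (`hκ`, `hlam`, `hn`) ∘ ★ `measureReal_support_hFamily_ne_zero`.
[cite: Rogawski1990, §4.9 Prop. 4.9.1 (b) p. 55; §4.3 (4.3.1) p. 43] -/
theorem rowOne_coefStar_of_hProfiles_affine :
    ∀ (L : Type) [Field L] [NumberField L] [IsCMField L]
      {v : HeightOneSpectrum (𝓞 ↥(maximalRealSubfield L))} (w : UnitaryGroup.PlacesOver L v)
      (hw : IsCMField.complexConj L • w.1 = w.1) (_he : v.asIdeal.ramificationIdx' w.1.asIdeal ≠ 1)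
      (_h2 : ¬ IsUnit (2 : 𝒪[w.1.adicCompletion L]))
      (ϖ : (w.1.adicCompletion L)) (_hϖ : Valued.v ϖ = WithZero.exp (-1 : ℤ)) (d tE : ℕ) (_hD : IsRamifiedQuadraticDatum (galAdicCompletionMap (L := L) (IsCMField.complexConj L) hw) ϖ d tE)
      [Fintype (Valued.ResidueField (w.1.adicCompletion L))] (δ : (w.1.adicCompletion L)) (_hδ : (galAdicCompletionMap (L := L) (IsCMField.complexConj L) hw) δ = -δ) (_hδ0 : δ ≠ 0)
      (μ : HeckeCharacter L) (_hμu : μ.IsUnitary)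
      (_hμω : ∀ x : ideleGroup ↥(maximalRealSubfield L), μ (AdeleRing.ideleBaseChange ↥(maximalRealSubfield L) L x) = quadraticHeckeCharCM L x)
      [MeasurableSpace ((UnitaryGroup.cmDatum L 3 (Matrix.of fun i j : Fin 3 => if i.val + j.val + 1 = 3 then (1 : L) else 0)).Local v)] [BorelSpace ((UnitaryGroup.cmDatum L 3 (Matrix.of fun i j : Fin 3 => if i.val + j.val + 1 = 3 then (1 : L) else 0)).Local v)]
      [∀ γ : ((UnitaryGroup.cmDatum L 3 (Matrix.of fun i j : Fin 3 => if i.val + j.val + 1 = 3 then (1 : L) else 0)).Local v), MeasurableSpace (((UnitaryGroup.cmDatum L 3 (Matrix.of fun i j : Fin 3 => if i.val + j.val + 1 = 3 then (1 : L) else 0)).Local v) ⧸ Subgroup.centralizer ({γ} : Set ((UnitaryGroup.cmDatum L 3 (Matrix.of fun i j : Fin 3 => if i.val + j.val + 1 = 3 then (1 : L) else 0)).Local v)))]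
      [∀ γ : ((UnitaryGroup.cmDatum L 3 (Matrix.of fun i j : Fin 3 => if i.val + j.val + 1 = 3 then (1 : L) else 0)).Local v), BorelSpace (((UnitaryGroup.cmDatum L 3 (Matrix.of fun i j : Fin 3 => if i.val + j.val + 1 = 3 then (1 : L) else 0)).Local v) ⧸ Subgroup.centralizer ({γ} : Set ((UnitaryGroup.cmDatum L 3 (Matrix.of fun i j : Fin 3 => if i.val + j.val + 1 = 3 then (1 : L) else 0)).Local v)))]
      [MeasurableSpace ((UnitaryGroup.cmDatum L 2 (Matrix.of fun i j : Fin 2 => if i.val + j.val + 1 = 2 then (1 : L) else 0)).Local v × (UnitaryGroup.cmDatum L 1 (Matrix.of fun i j : Fin 1 => if i.val + j.val + 1 = 1 then (1 : L) else 0)).Local v)] [BorelSpace ((UnitaryGroup.cmDatum L 2 (Matrix.of fun i j : Fin 2 => if i.val + j.val + 1 = 2 then (1 : L) else 0)).Local v × (UnitaryGroup.cmDatum L 1 (Matrix.of fun i j : Fin 1 => if i.val + j.val + 1 = 1 then (1 : L) else 0)).Local v)]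
      [∀ a : ((UnitaryGroup.cmDatum L 2 (Matrix.of fun i j : Fin 2 => if i.val + j.val + 1 = 2 then (1 : L) else 0)).Local v × (UnitaryGroup.cmDatum L 1 (Matrix.of fun i j : Fin 1 => if i.val + j.val + 1 = 1 then (1 : L) else 0)).Local v), MeasurableSpace (((UnitaryGroup.cmDatum L 2 (Matrix.of fun i j : Fin 2 => if i.val + j.val + 1 = 2 then (1 : L) else 0)).Local v × (UnitaryGroup.cmDatum L 1 (Matrix.of fun i j : Fin 1 => if i.val + j.val + 1 = 1 then (1 : L) else 0)).Local v) ⧸ Subgroup.centralizer ({a} : Set ((UnitaryGroup.cmDatum L 2 (Matrix.of fun i j : Fin 2 => if i.val + j.val + 1 = 2 then (1 : L) else 0)).Local v × (UnitaryGroup.cmDatum L 1 (Matrix.of fun i j : Fin 1 => if i.val + j.val + 1 = 1 then (1 : L) else 0)).Local v)))]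
      [∀ a : ((UnitaryGroup.cmDatum L 2 (Matrix.of fun i j : Fin 2 => if i.val + j.val + 1 = 2 then (1 : L) else 0)).Local v × (UnitaryGroup.cmDatum L 1 (Matrix.of fun i j : Fin 1 => if i.val + j.val + 1 = 1 then (1 : L) else 0)).Local v), BorelSpace (((UnitaryGroup.cmDatum L 2 (Matrix.of fun i j : Fin 2 => if i.val + j.val + 1 = 2 then (1 : L) else 0)).Local v × (UnitaryGroup.cmDatum L 1 (Matrix.of fun i j : Fin 1 => if i.val + j.val + 1 = 1 then (1 : L) else 0)).Local v) ⧸ Subgroup.centralizer ({a} : Set ((UnitaryGroup.cmDatum L 2 (Matrix.of fun i j : Fin 2 => if i.val + j.val + 1 = 2 then (1 : L) else 0)).Local v × (UnitaryGroup.cmDatum L 1 (Matrix.of fun i j : Fin 1 => if i.val + j.val + 1 = 1 then (1 : L) else 0)).Local v)))]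
      (νH : Measure ((UnitaryGroup.cmDatum L 2 (Matrix.of fun i j : Fin 2 => if i.val + j.val + 1 = 2 then (1 : L) else 0)).Local v × (UnitaryGroup.cmDatum L 1 (Matrix.of fun i j : Fin 1 => if i.val + j.val + 1 = 1 then (1 : L) else 0)).Local v)) [νH.IsHaarMeasure] [νH.IsMulRightInvariant]
      (νG₃ : Measure ((UnitaryGroup.cmDatum L 3 (Matrix.of fun i j : Fin 3 => if i.val + j.val + 1 = 3 then (1 : L) else 0)).Local v)) [νG₃.IsHaarMeasure] [νG₃.IsMulRightInvariant]
      (mH : OrbitalMeasureFamily ((UnitaryGroup.cmDatum L 2 (Matrix.of fun i j : Fin 2 => if i.val + j.val + 1 = 2 then (1 : L) else 0)).Local v × (UnitaryGroup.cmDatum L 1 (Matrix.of fun i j : Fin 1 => if i.val + j.val + 1 = 1 then (1 : L) else 0)).Local v)) (mG₃ : OrbitalMeasureFamily ((UnitaryGroup.cmDatum L 3 (Matrix.of fun i j : Fin 3 => if i.val + j.val + 1 = 3 then (1 : L) else 0)).Local v))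
      (_hmH : mH.IsCanonical (IsLocalGRegular L v) νH) (_hmG : mG₃.IsCanonical (fun γ => IsRegularElt (γ.val : GL (Fin 3) (UnitaryGroup.LocalRing L v))) νG₃)
      (N : Submodule (Valued.integer (w.1.adicCompletion L)) (Fin 3 → (w.1.adicCompletion L))) (_hN : IsVertexLattice (galAdicCompletionMap (L := L) (IsCMField.complexConj L) hw) ϖ ((StdForm.antidiagonal 3).over (w.1.adicCompletion L)) 0 N)
      (Kt : Subgroup ((UnitaryGroup.cmDatum L 3 (Matrix.of fun i j : Fin 3 => if i.val + j.val + 1 = 3 then (1 : L) else 0)).Local v)) (_hKt : ∀ u : ((UnitaryGroup.cmDatum L 3 (Matrix.of fun i j : Fin 3 => if i.val + j.val + 1 = 3 then (1 : L) else 0)).Local v), u ∈ Kt ↔ mapGL ((localNonsplitEquiv (IsCMField.complexConj L) (Matrix.of fun i j : Fin 3 => if i.val + j.val + 1 = 3 then (1 : L) else 0) (IsCMField.complexConj_ne_one L) w hw u :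
              ↥(unitaryGroupOfForm (galAdicCompletionMap (L := L) (IsCMField.complexConj L) hw) (placeForm (Matrix.of fun i j : Fin 3 => if i.val + j.val + 1 = 3 then (1 : L) else 0) w.1))) : GL (Fin 3) (w.1.adicCompletion L)) N = N)
      (C : ℂ)
      (_h1a : ∃ V ∈ 𝓝 (1 : ((UnitaryGroup.cmDatum L 2 (Matrix.of fun i j : Fin 2 => if i.val + j.val + 1 = 2 then (1 : L) else 0)).Local v × (UnitaryGroup.cmDatum L 1 (Matrix.of fun i j : Fin 1 => if i.val + j.val + 1 = 1 then (1 : L) else 0)).Local v)), ∀ γH ∈ V, IsLocalGRegular L v γH →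
              ∀ (α γ : (w.1.adicCompletion L)), ((((γH).1.val : GL (Fin 2) (UnitaryGroup.LocalRing L v)).val.map (Pi.evalRingHom (fun w' : UnitaryGroup.PlacesOver L v => w'.1.adicCompletion L) w))).charpoly.IsRoot α → ((((γH).1.val : GL (Fin 2) (UnitaryGroup.LocalRing L v)).val.map (Pi.evalRingHom (fun w' : UnitaryGroup.PlacesOver L v => w'.1.adicCompletion L) w))).charpoly.IsRoot γ → α ≠ γ → α * (galAdicCompletionMap (L := L) (IsCMField.complexConj L) hw) α = 1 → γ * (galAdicCompletionMap (L := L) (IsCMField.complexConj L) hw) γ = 1 →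
                ∀ N : ℕ, Valued.v (α - γ) = WithZero.exp (-(N : ℤ)) → depthOfRecord d ≤ N → (N + d) % 2 = 0 →
                  ∀ s : Fin 2, stableOrbitalIntegralRel (IsLocalStablyConjH L v) mH (hFamily L w hw ϖ s) γH =
                    (2 * (νH.real (Function.support (hFamily L w hw ϖ s)) : ℂ)) * (((2 * ((Fintype.card (Valued.ResidueField (w.1.adicCompletion L)) : ℚ) ^ (((N - d) / 2 : ℕ) + 1) - 1) / ((Fintype.card (Valued.ResidueField (w.1.adicCompletion L)) : ℚ) - 1) : ℚ)) : ℂ) + (if ((s : Fin 2) : ℕ) = d % 2 then (0 : ℂ) else -2 * (νH.real (Function.support (hFamily L w hw ϖ s)) : ℂ))),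
        ∃ V ∈ 𝓝 (1 : ((UnitaryGroup.cmDatum L 2 (Matrix.of fun i j : Fin 2 => if i.val + j.val + 1 = 2 then (1 : L) else 0)).Local v × (UnitaryGroup.cmDatum L 1 (Matrix.of fun i j : Fin 1 => if i.val + j.val + 1 = 1 then (1 : L) else 0)).Local v)), ∀ γH ∈ V, IsLocalGRegular L v γH →
          ∀ (f : Fin 4 → Fin 3 → (Fin 3 → (w.1.adicCompletion L))) (_hf : IsFourFrameFamily (galAdicCompletionMap (L := L) (IsCMField.complexConj L) hw) f)
        (a b z : (w.1.adicCompletion L)) (_ha : a * (galAdicCompletionMap (L := L) (IsCMField.complexConj L) hw) a = 1) (_hb : b * (galAdicCompletionMap (L := L) (IsCMField.complexConj L) hw) b = 1) (_hz : z * (galAdicCompletionMap (L := L) (IsCMField.complexConj L) hw) z = 1)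
        (_hzγ : z = finGammaTwo L v γH w) (_hra : ((((γH).1.val : GL (Fin 2) (UnitaryGroup.LocalRing L v)).val.map (Pi.evalRingHom (fun w' : UnitaryGroup.PlacesOver L v => w'.1.adicCompletion L) w))).charpoly.IsRoot (z * (a * a))) (_hrb : ((((γH).1.val : GL (Fin 2) (UnitaryGroup.LocalRing L v)).val.map (Pi.evalRingHom (fun w' : UnitaryGroup.PlacesOver L v => w'.1.adicCompletion L) w))).charpoly.IsRoot (z * (b * b)))
        (_ha1 : Valued.v (a - 1) < Valued.v (2 : (w.1.adicCompletion L))) (_hb1 : Valued.v (b - 1) < Valued.v (2 : (w.1.adicCompletion L)))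
        (n₁ n₂ n₃ : ℕ) (_hE : IsElementDatum (galAdicCompletionMap (L := L) (IsCMField.complexConj L) hw) ϖ (depthOfRecord d) (a * a) (b * b) n₁ n₂ n₃)
        (k : ℕ) (_hk : 2 * k + d = n₁ + n₂ + n₃ + 2)
        (Γ : Fin 4 → GL (Fin 3) (w.1.adicCompletion L)) (_hΓ : ∀ b', (Γ b' : Matrix (Fin 3) (Fin 3) (w.1.adicCompletion L)) = frameElt (galAdicCompletionMap (L := L) (IsCMField.complexConj L) hw) f b' (a * a) (b * b))
        (tb : Fin 4 → ((UnitaryGroup.cmDatum L 3 (Matrix.of fun i j : Fin 3 => if i.val + j.val + 1 = 3 then (1 : L) else 0)).Local v)) (_htb : ∀ b', ((((localNonsplitEquiv (IsCMField.complexConj L) (Matrix.of fun i j : Fin 3 => if i.val + j.val + 1 = 3 then (1 : L) else 0) (IsCMField.complexConj_ne_one L) w hw (tb b') :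
              ↥(unitaryGroupOfForm (galAdicCompletionMap (L := L) (IsCMField.complexConj L) hw) (placeForm (Matrix.of fun i j : Fin 3 => if i.val + j.val + 1 = 3 then (1 : L) else 0) w.1))) : GL (Fin 3) (w.1.adicCompletion L)) : Matrix (Fin 3) (Fin 3) (w.1.adicCompletion L))) = z • (Γ b' : Matrix (Fin 3) (Fin 3) (w.1.adicCompletion L)))
            (i : Fin 3) (B : ℤ), 2 * B = ((![n₁, n₂, n₃] : Fin 3 → ℕ) i : ℤ) - d + 2 - 2 * shiftR d tE →
            (∀ t' : ((UnitaryGroup.cmDatum L 3 (Matrix.of fun i j : Fin 3 => if i.val + j.val + 1 = 3 then (1 : L) else 0)).Local v), IsLocalNormPair L (Matrix.of fun i j : Fin 3 => if i.val + j.val + 1 = 3 then (1 : L) else 0) v γH t' ↔ ∃ b', ConjClasses.mk t' = ConjClasses.mk (tb b')) →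
            (∀ b' : Fin 4, ((finExplicitCollection L (Matrix.of fun i j : Fin 3 => if i.val + j.val + 1 = 3 then (1 : L) else 0) μ (finExplicitDelta_conj_left_all L (Matrix.of fun i j : Fin 3 => if i.val + j.val + 1 = 3 then (1 : L) else 0) μ) (finExplicitDelta_conj_right_all L (Matrix.of fun i j : Fin 3 => if i.val + j.val + 1 = 3 then (1 : L) else 0) μ)) v).Δ γH (tb b') = ((finExplicitCollection L (Matrix.of fun i j : Fin 3 => if i.val + j.val + 1 = 3 then (1 : L) else 0) μ (finExplicitDelta_conj_left_all L (Matrix.of fun i j : Fin 3 => if i.val + j.val + 1 = 3 then (1 : L) else 0) μ) (finExplicitDelta_conj_right_all L (Matrix.of fun i j : Fin 3 => if i.val + j.val + 1 = 3 then (1 : L) else 0) μ)) v).Δ γH (tb 0) * (kappaChar i b' : ℂ)) →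
            ∑ s, ((if ((s : Fin 2) : ℕ) = d % 2 then C * ((((Fintype.card (Valued.ResidueField (w.1.adicCompletion L)) : ℕ) : ℂ) + 1) - 2 * ((Fintype.card (Valued.ResidueField (w.1.adicCompletion L)) : ℕ) : ℂ) ^ (shiftR d tE)) else 2 * C * (((Fintype.card (Valued.ResidueField (w.1.adicCompletion L)) : ℕ) : ℂ) ^ (shiftR d tE) - 1)) / ((((Fintype.card (Valued.ResidueField (w.1.adicCompletion L)) : ℕ) : ℂ) - 1) * (νH.real (Function.support (hFamily L w hw ϖ s)) : ℂ))) * stableOrbitalIntegralRel (IsLocalStablyConjH L v) mH (hFamily L w hw ϖ s) γH =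
              ((finExplicitCollection L (Matrix.of fun i j : Fin 3 => if i.val + j.val + 1 = 3 then (1 : L) else 0) μ (finExplicitDelta_conj_left_all L (Matrix.of fun i j : Fin 3 => if i.val + j.val + 1 = 3 then (1 : L) else 0) μ) (finExplicitDelta_conj_right_all L (Matrix.of fun i j : Fin 3 => if i.val + j.val + 1 = 3 then (1 : L) else 0) μ)) v).Δ γH (tb 0) * C *
                (((baseSign (galAdicCompletionMap (L := L) (IsCMField.complexConj L) hw) i * normSign (galAdicCompletionMap (L := L) (IsCMField.complexConj L) hw) (fPartProd δ ![a, b, 1] i) : ℤ) : ℂ) *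
                  ((ampl (Fintype.card (Valued.ResidueField (w.1.adicCompletion L))) k (if (0 : ℕ) = 0 then B else B + tauOfRecord d) : ℚ) : ℂ)) :=
  fun L _ _ _ _ w hw he h2 ϖ hϖ d tE hD _ δ hδ hδ0 μ hμu hμω _ _ _ _ _ _ _ _ νH _ _ νG₃ _ _ mH mG₃ hmH hmG N hN Kt hKt C h1a =>
    F0P3cDyRamRowOneReductionDepth.rowOne_of_hSideIdentity_depth shiftR depthOfRecord tauOfRecord 0 L w hw he h2 ϖ hϖ d tE hD δ hδ hδ0 μ hμu hμω
      νH νG₃ mH mG₃ hmH hmG N hN Kt hKt C (hFamily L w hw ϖ)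
      (fun s : Fin 2 => ((if ((s : Fin 2) : ℕ) = d % 2 then C * ((((Fintype.card (Valued.ResidueField (w.1.adicCompletion L)) : ℕ) : ℂ) + 1) - 2 * ((Fintype.card (Valued.ResidueField (w.1.adicCompletion L)) : ℕ) : ℂ) ^ (shiftR d tE)) else 2 * C * (((Fintype.card (Valued.ResidueField (w.1.adicCompletion L)) : ℕ) : ℂ) ^ (shiftR d tE) - 1)) / ((((Fintype.card (Valued.ResidueField (w.1.adicCompletion L)) : ℕ) : ℂ) - 1) * (νH.real (Function.support (hFamily L w hw ϖ s)) : ℂ))))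
      (F0P3cDyRamRowOneHSideAssembly.hH_rowOne_hFamily_of_affine L w hw he ϖ d tE hD δ hδ hδ0 μ mH C
        (fun s : Fin 2 => ((if ((s : Fin 2) : ℕ) = d % 2 then C * ((((Fintype.card (Valued.ResidueField (w.1.adicCompletion L)) : ℕ) : ℂ) + 1) - 2 * ((Fintype.card (Valued.ResidueField (w.1.adicCompletion L)) : ℕ) : ℂ) ^ (shiftR d tE)) else 2 * C * (((Fintype.card (Valued.ResidueField (w.1.adicCompletion L)) : ℕ) : ℂ) ^ (shiftR d tE) - 1)) / ((((Fintype.card (Valued.ResidueField (w.1.adicCompletion L)) : ℕ) : ℂ) - 1) * (νH.real (Function.support (hFamily L w hw ϖ s)) : ℂ))))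
        (fun s : Fin 2 => (2 * (νH.real (Function.support (hFamily L w hw ϖ s)) : ℂ)))
        (fun s : Fin 2 => (if ((s : Fin 2) : ℕ) = d % 2 then (0 : ℂ) else -2 * (νH.real (Function.support (hFamily L w hw ϖ s)) : ℂ)))
        (fun N : ℕ => ((N - d) / 2 : ℕ))
        h1a (radiusStar_spec d)
        (sum_coefStar_mul_kappaStar (C := C) (natCast_card_residueField_sub_one_ne_zero L w) (F0P3cDyRamRowThreeReduction.measureReal_support_hFamily_ne_zero L w hw he ϖ hϖ νH 0) (F0P3cDyRamRowThreeReduction.measureReal_support_hFamily_ne_zero L w hw he ϖ hϖ νH 1) d (shiftR d tE))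
        (sum_coefStar_mul_lamStar_cast (C := C) (Fintype.card (Valued.ResidueField (w.1.adicCompletion L))) (natCast_card_residueField_sub_one_ne_zero L w) (F0P3cDyRamRowThreeReduction.measureReal_support_hFamily_ne_zero L w hw he ϖ hϖ νH 0) (F0P3cDyRamRowThreeReduction.measureReal_support_hFamily_ne_zero L w hw he ϖ hϖ νH 1) d (shiftR d tE)))

end Head

end Summit.HodgeConjecture.HodgeConjecture.Cruxes.H413.F0P3cDyRamRowOneAtCoefStar

end
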